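import Literature.AnabelianGeometry.AbsoluteAnabelian.MLFGaloisTMIsoUnitsTransport
import Literature.AnabelianGeometry.AbsoluteAnabelian.UnitKummerCyclotomeJunctionFundamental
import HarnessLib

/-!
# Rmk 3.2.1 on THE datum: abc-iut-L4-t2's `Λ(rootsHom)` IS the inverse of the shared junction
# `cyclotomeUnitsEquivMuZhatFund`, and THE junctions intertwine `Λ(f_M^gp)` with `μ_Ẑ(ᾱ)`

S. Mochizuki, *Topics in Absolute Anabelian Geometry III*, §3, Rmk. 3.2.1 p. 73 («a functorial algorithm for
constructing the natural isomorphism `μ_Ẑ(M_TM) ⥲ μ_Ẑ(G)`»), Prop. 3.2 (ii) p. 72, Prop. 3.3 (i) p. 73 (bib key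
`MochizukiAbsTopIII2015`); [AbsAnab] Prop. 1.2.1 (vi) p. 10 (bib key `MochizukiAbsAnab2004`).

PROOF-ONLY junction bridge (abc-iut cell, layer L4; L4-lead RULING #8i (5): «t2: adopt
`cyclotomeUnitsEquivMuZhatFund` as the shared junction name or say why not» — ADOPTED).  Two spellings of
Rmk. 3.2.1's identification built from a torsion reciprocity datum `D` live in the tree:
abc-iut-L4-t2's `Λ(rootsHom C D) : μ_Ẑ(G_k) → Λ(k̄ˣ)` (`MonoidKummerGaloisCyclotome.lean`, p432641 — the
coefficient map of the `μ_Ẑ(G)`-valued Kummer maps `kummerMuZhat` of the `TM`-side) and abc-iut-w4-d009's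
junction `MLFClosure.cyclotomeUnitsEquivMuZhatOf C D : Λ(k̄ˣ) ≃* μ_Ẑ(G_k)` (`UnitKummerCyclotomeJunctionFundamental`,
p442940 — the cyclotome slot of the presented `TLG`/`TCG` unit Kummer theories), with THE datum
`TorsionReciprocityData.fundamental k` (abc-iut-w6-d022) giving `cyclotomeUnitsEquivMuZhatFund`.  This file
proves they are ONE identification:

* `MLFClosure.cyclotomeUnitsEquivMuZhatOf_symm_apply` — `(cyclotomeUnitsEquivMuZhatOf C D)⁻¹ = Λ(rootsHom C D)`
  (componentwise `rfl`); `…Of_apply_cyclotome_map_rootsHom`, `…Fund_symm_apply`;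
* `GaloisMonoidPair.Iso.cyclotomeUnitsEquivMuZhatFund_map_unitsLift` — for an isomorphism `f` of model
  `TM`-pairs (abc-iut-L4-t2 `MLFGaloisTMIsoUnitsTransport`, p441441): THE junctions intertwine `Λ(f_M^gp)` with
  the group-theoretic `μ_Ẑ(ᾱ)` — `junction₂ (Λ(f_M^gp) ξ) = μ_Ẑ(ᾱ) (junction₁ ξ)` — the coefficient square
  `cyclotome_map_rootsHom_muZhat_map` read through the shared name, i.e. the form the `TLG`/`TCG`
  presentations (`unitKummerTheoryMuZhatFund`) consume.

Theorems only; classical.  HONEST FRAMING: nothing here bears on [IUTchIII] Cor. 3.12; no side is taken;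
nothing asserts that abc is proved or refuted.
-/

noncomputable section

namespace Literature.AnabelianGeometry.AbsoluteAnabelian

open Field

namespace MLFClosure

variable (C : MLFClosure.{0}) (D : TorsionReciprocityData C.k)

/-- **`(cyclotomeUnitsEquivMuZhatOf C D)⁻¹ = Λ(rootsHom C D)`**: abc-iut-w4-d009's junction inverted IS
abc-iut-L4-t2's coefficient map of Rmk. 3.2.1 (both: `Λ` of `μ_{ℚ/ℤ}(G_k) ⥲ (k^algˣ)_tors ⊆ k^algˣ ≃ k̄ˣ`).
[cite: MochizukiAbsTopIII2015, Remark 3.2.1 p.73] -/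
theorem cyclotomeUnitsEquivMuZhatOf_symm_apply (ζ : muZhat (absoluteGaloisGroup C.k)) :
    (C.cyclotomeUnitsEquivMuZhatOf D).symm ζ = EtaleTheta.cyclotome.map (ModelMLFGaloisData.rootsHom C D) ζ := by
  refine Subtype.ext (funext fun n => Units.ext ?_)
  rw [cyclotomeUnitsEquivMuZhatOf_symm_apply_coe, EtaleTheta.cyclotome.map_apply,
    ModelMLFGaloisData.coe_rootsHom, TorsionReciprocityData.muZhatEquiv_apply_coe]

/-- `cyclotomeUnitsEquivMuZhatOf C D (Λ(rootsHom C D) ζ) = ζ`. [cite: MochizukiAbsTopIII2015, Remark 3.2.1 p.73] -/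
theorem cyclotomeUnitsEquivMuZhatOf_apply_cyclotome_map_rootsHom (ζ : muZhat (absoluteGaloisGroup C.k)) :
    C.cyclotomeUnitsEquivMuZhatOf D (EtaleTheta.cyclotome.map (ModelMLFGaloisData.rootsHom C D) ζ) = ζ := by
  rw [← cyclotomeUnitsEquivMuZhatOf_symm_apply, MulEquiv.apply_symm_apply]

/-- **THE junction inverted is `Λ(rootsHom C (fundamental k))`** — the coefficient map of the `μ_Ẑ(G)`-valued
Kummer maps built from THE datum (`MonoidKummerGaloisCyclotomeCanonical`).
[cite: MochizukiAbsTopIII2015, Remark 3.2.1 p.73] -/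
theorem cyclotomeUnitsEquivMuZhatFund_symm_apply (ζ : muZhat (absoluteGaloisGroup C.k)) :
    C.cyclotomeUnitsEquivMuZhatFund.symm ζ =
      EtaleTheta.cyclotome.map (ModelMLFGaloisData.rootsHom C (TorsionReciprocityData.fundamental C.k)) ζ :=
  C.cyclotomeUnitsEquivMuZhatOf_symm_apply _ ζ

/-- The coefficient isomorphism of the `μ_Ẑ(G)`-valued Kummer maps through the shared junction:
`coeffIso (kummerMuZhat m) = κ_H(m)` reads `Λ(junction⁻¹) (κ^G_H(m)) = κ_H(m)` on coefficients — recorded as the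
identity of coefficient maps `Λ(rootsHom) = junction⁻¹` (as functions).
[cite: MochizukiAbsTopIII2015, Proposition 3.2 (ii) p.72] -/
theorem coe_cyclotomeUnitsEquivMuZhatOf_symm :
    ((C.cyclotomeUnitsEquivMuZhatOf D).symm : muZhat (absoluteGaloisGroup C.k) → EtaleTheta.cyclotome (C.K)ˣ) =
      EtaleTheta.cyclotome.map (ModelMLFGaloisData.rootsHom C D) :=
  funext (C.cyclotomeUnitsEquivMuZhatOf_symm_apply D)

end MLFClosure

namespace GaloisMonoidPair.Iso

variable {C₁ C₂ : MLFClosure.{0}} {D₁ : ModelMLFGaloisData C₁.k C₁.K} {D₂ : ModelMLFGaloisData C₂.k C₂.K}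
  (f : GaloisMonoidPair.Iso D₁.tmPair D₂.tmPair)

/-- **THE junctions intertwine `Λ(f_M^gp)` with `μ_Ẑ(ᾱ)`** along an isomorphism `f` of model `TM`-pairs:
`C₂.cyclotomeUnitsEquivMuZhatFund (Λ(unitsLift f_M) ξ) = μ_Ẑ(ᾱ) (C₁.cyclotomeUnitsEquivMuZhatFund ξ)` for
`ξ ∈ Λ(k̄₁ˣ)` — the coefficient square `cyclotome_map_rootsHom_muZhat_map` (p441441) through the shared name: the
cyclotome slots of abc-iut-w4-d009's presented unit Kummer theories on THE datum are functorial in isomorphisms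
of pairs via the GROUP-THEORETIC `μ_Ẑ(ᾱ)`. [cite: MochizukiAbsTopIII2015, Remark 3.2.1 p.73] -/
theorem cyclotomeUnitsEquivMuZhatFund_map_unitsLift (ξ : EtaleTheta.cyclotome (C₁.K)ˣ) :
    C₂.cyclotomeUnitsEquivMuZhatFund
        (EtaleTheta.cyclotome.map (ModelMLFGaloisData.unitsLift f.isoM.toMonoidHom) ξ) =
      muZhat.map f.absGaloisIso (C₁.cyclotomeUnitsEquivMuZhatFund ξ) := by
  -- write `ξ = Λ(rootsHom₁) ζ` with `ζ := junction₁ ξ`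
  obtain ⟨ζ, rfl⟩ : ∃ ζ, EtaleTheta.cyclotome.map
      (ModelMLFGaloisData.rootsHom C₁ (TorsionReciprocityData.fundamental C₁.k)) ζ = ξ :=
    ⟨C₁.cyclotomeUnitsEquivMuZhatFund ξ, by
      rw [← MLFClosure.cyclotomeUnitsEquivMuZhatFund_symm_apply, MulEquiv.symm_apply_apply]⟩
  rw [← f.cyclotome_map_rootsHom_muZhat_map ζ, ← MLFClosure.cyclotomeUnitsEquivMuZhatFund_symm_apply,
    ← MLFClosure.cyclotomeUnitsEquivMuZhatFund_symm_apply, MulEquiv.apply_symm_apply, MulEquiv.apply_symm_apply]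

/-- The same with `μ_Ẑ(ᾱ)` on the left: `junction₂⁻¹ (μ_Ẑ(ᾱ) η) = Λ(f_M^gp) (junction₁⁻¹ η)` for `η ∈ μ_Ẑ(G_{k₁})`.
[cite: MochizukiAbsTopIII2015, Remark 3.2.1 p.73] -/
theorem cyclotomeUnitsEquivMuZhatFund_symm_muZhat_map (η : muZhat (absoluteGaloisGroup C₁.k)) :
    C₂.cyclotomeUnitsEquivMuZhatFund.symm (muZhat.map f.absGaloisIso η) =
      EtaleTheta.cyclotome.map (ModelMLFGaloisData.unitsLift f.isoM.toMonoidHom)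
        (C₁.cyclotomeUnitsEquivMuZhatFund.symm η) := by
  rw [MLFClosure.cyclotomeUnitsEquivMuZhatFund_symm_apply, MLFClosure.cyclotomeUnitsEquivMuZhatFund_symm_apply,
    f.cyclotome_map_rootsHom_muZhat_map]

end GaloisMonoidPair.Iso

end Literature.AnabelianGeometry.AbsoluteAnabelian

end
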